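import Literature.Probability.Moments.NonnegativeLowerTail
import Literature.Probability.Moments.BennettBernsteinMeasure
import Summits.Ventures.LatticeQCDFlow.Scoring.ParityLegConfidence
import HarnessLib

/-!
# The acceptance column from paired model draws: a two-sided certificate for `acc(p, q)` whose
# rate does not see the weight ceiling, and the A-vs-B acceptance comparison WITHOUT a parity
# hypothesis

HONEST FRAMING: exact (Metropolis-corrected) sampling algorithms for lattice gauge theory;
figures of merit are autocorrelation/cost numbers at stated couplings and volumes; no
continuum-physics claim.

Venture `LatticeQCDFlow` (cell pub-lqcd), topic `Scoring`; FANOUT row 4 (`s0-u1-b`, rung S0-B: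
two independent codes A, B for the 2D U(1) flow sampler; acceptance test "A vs B within 3 pp").
The parity-leg files (`Scoring/ParityLeg*`) bound the DISCREPANCY `|acc(p,q) − acc(p,q')|` of the
two codes' equilibrium acceptances under a density-parity hypothesis.  This file certifies each
acceptance DIRECTLY, with no hypothesis relating the two codes, from the one resource a flow
provides for free — independent proposals — used in disjoint PAIRS.  The equilibrium acceptance of
the flow (independence Metropolis) sampler with normalised target `p` and model `q > 0` is
`acc(p,q) = ∫∫ min(p(a)q(b), p(b)q(a)) dμ dμ` (`Exactness.FlowAcceptanceModelLipschitz`), and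

  `min(p(a)q(b), p(b)q(a)) = q(a)q(b)·min(w(a), w(b))`, `w = p/q`,

so `acc(p,q) = E min(w(x), w(x'))` for an INDEPENDENT PAIR `x, x'` of model draws: the pair-minimum
of importance ratios is an unbiased one-pair estimator.  Under a weight ceiling `p ≤ Wq` it lies in
`[0, W]`, but its SECOND MOMENT is at most `E[w(x)w(x')] = (∫p)² = 1` whatever `W` is
(`min(u,v)² ≤ uv`).  Hence, for `k` independent pairs with pair-minimum sum `V`:
* lower tail (Maurer 2003 / BLM Ex. 2.9, tree `Literature…NonnegativeLowerTail`, second moment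
  only): `P(V + kt ≤ k·acc) ≤ exp(−kt²/2)` — NO dependence on `W`;
* upper tail (Bernstein, BLM (2.10), tree `Literature…BennettBernsteinMeasure`, summands `≤ W`,
  variance proxy `1`): `P(k(acc + t) ≤ V) ≤ exp(−kt²/(2(1 + Wt/3)))` — `W` enters only through
  `Wt/3`.
(Hoeffding would give `exp(−2kt²/W²)`.)  NEW WORK of the cell (elementary); cited facts are BLM
2013 Ex. 2.9 and eq. (2.10), both proved in the tree; no definition is introduced.

## Setting

`(Ω, P)` a probability space; `(X, μ)` s-finite; `p ≥ 0` measurable, `∫ p = 1`; `q > 0` measurable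
integrable; PAIRS `(xᵢ, x'ᵢ)`: measurable, laws `μ.withDensity q`, `xᵢ ⟂ x'ᵢ` (`hin`), pairs
independent across `i` (`hpair : iIndepFun (fun i ω => (xᵢ ω, x'ᵢ ω)) P`) — e.g. disjoint pairs of
one i.i.d. proposal stream; `k = #s`; `V = Σ_{i∈s} min(p(xᵢ)/q(xᵢ), p(x'ᵢ)/q(x'ᵢ))`.

## What is proved

§1 `map_pair_eq_withDensity_prod`, `integral_pair_eq` (the pair has density `q ⊗ q` w.r.t.
`μ ⊗ μ`; `E H(x,x') = ∫ H·(q⊗q)`).  §2 `min_div_mul_eq_min_mul`, **`integral_pairMin_eq_meanAccept`**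
(`∫ min(w,w')·(q⊗q) = acc(p,q)`), `integral_pairMin_comp_eq_meanAccept` (unbiasedness),
**`integral_sq_pairMin_comp_le_one`** (`E min(w(x),w(x'))² ≤ 1`).  §3
**`acceptance_pairedDraws_lower/upper/confidence`**: `P(t ≤ |V/k − acc(p,q)|) ≤ exp(−kt²/2) +
exp(−kt²/(2(1 + Wt/3)))` (`k ≥ 1`, `t > 0`, ceiling `p ≤ Wq`).  §4
**`acceptance_AB_pairedDraws_confidence`** — two codes `q, q'` (ceilings `W, W'`), paired draws
from each, NOTHING assumed between the codes or the legs: `P( t + t' ≤ |(V/k − V'/k') − (acc(p,q)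
− acc(p,q'))| )` is at most the sum of the two two-sided bounds.

Reading for row 4 (value-free; no number of ours, no sealed value): each code's equilibrium
acceptance is a certified reading from `2k` of its own proposals and normalised weights, to `±t`
at a rate `kt²/2` that a poor weight ceiling does not degrade; the A-vs-B acceptance difference is
certified to `±(t + t')` around the difference of the pair estimates, with no density parity
between the codes.  NOT CLAIMED: unnormalised weights (the printed monitor is a RATIO `U/W̄`, row
3's `Scoring/AcceptanceMonitorConcentration`, finite frame, Chebyshev level); the all-pairs
U-statistic (Hoeffding 1963 §5); the bookkeeping that disjoint pairs of one i.i.d. stream satisfy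
`hpair`/`hin`; the realised acceptance RATE of a finite chain; any number re-scored.
-/

noncomputable section

namespace Summit.Ventures.LatticeQCDFlow.Scoring.PairedDraws

open MeasureTheory ProbabilityTheory Finset Real Set

variable {Ω : Type*} [MeasurableSpace Ω] {P : Measure Ω} [IsProbabilityMeasure P] {ι : Type*}
variable {X : Type*} [MeasurableSpace X] {μ : Measure X} [SFinite μ]

/-! ## §1 The law of an independent pair of model draws -/

omit [IsProbabilityMeasure P] in
/-- **An independent pair of model draws has density `q ⊗ q` w.r.t. `μ ⊗ μ`.**  If `x, x'` are
measurable, independent, each with law `μ.withDensity q` (`q ≥ 0` measurable), then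
`P ∘ (x, x')⁻¹ = (μ ⊗ μ).withDensity (q(a)q(b))`. [folklore] -/
theorem map_pair_eq_withDensity_prod [IsFiniteMeasure P] {x x' : Ω → X} (hxm : Measurable x)
    (hxm' : Measurable x') (hin : IndepFun x x' P) {q : X → ℝ} (hq0 : ∀ y, 0 ≤ q y)
    (hqm : Measurable q) (hlaw : Measure.map x P = μ.withDensity fun y => ENNReal.ofReal (q y))
    (hlaw' : Measure.map x' P = μ.withDensity fun y => ENNReal.ofReal (q y)) :
    Measure.map (fun ω => (x ω, x' ω)) P
      = (μ.prod μ).withDensity fun z => ENNReal.ofReal (q z.1 * q z.2) := by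
  rw [(indepFun_iff_map_prod_eq_prod_map_map hxm.aemeasurable hxm'.aemeasurable).1 hin, hlaw,
    hlaw', prod_withDensity hqm.ennreal_ofReal hqm.ennreal_ofReal]
  congr 1
  funext z
  rw [ENNReal.ofReal_mul (hq0 _)]

/-- **Pair dictionary.**  Under the same hypotheses, for every measurable `H : X × X → ℝ`:
`∫ H(x ω, x' ω) dP = ∫ H(z)·q(z.1)q(z.2) d(μ ⊗ μ)(z)`. [folklore] -/
theorem integral_pair_eq {x x' : Ω → X} (hxm : Measurable x) (hxm' : Measurable x')
    (hin : IndepFun x x' P) {q : X → ℝ} (hq0 : ∀ y, 0 ≤ q y) (hqm : Measurable q)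
    (hlaw : Measure.map x P = μ.withDensity fun y => ENNReal.ofReal (q y))
    (hlaw' : Measure.map x' P = μ.withDensity fun y => ENNReal.ofReal (q y)) {H : X × X → ℝ}
    (hHm : Measurable H) :
    ∫ ω, H (x ω, x' ω) ∂P = ∫ z, H z * (q z.1 * q z.2) ∂(μ.prod μ) :=
  ParityLeg.integral_comp_eq_integral_mul_of_map_eq (x := fun ω => (x ω, x' ω))
    (hxm.prodMk hxm') (fun _ => mul_nonneg (hq0 _) (hq0 _))
    ((hqm.comp measurable_fst).mul (hqm.comp measurable_snd))
    (map_pair_eq_withDensity_prod hxm hxm' hin hq0 hqm hlaw hlaw') hHm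

/-! ## §2 The pair-minimum of importance ratios: mean `acc`, second moment `≤ 1` -/

omit [MeasurableSpace X] [SFinite μ] in
/-- The displayed identity: `min(p(a)/q(a), p(b)/q(b))·(q(a)q(b)) = min(p(a)q(b), p(b)q(a))`
for `q > 0`. [folklore] -/
theorem min_div_mul_eq_min_mul {p q : X → ℝ} (hq0 : ∀ y, 0 < q y) (a b : X) :
    min (p a / q a) (p b / q b) * (q a * q b) = min (p a * q b) (p b * q a) := by
  rw [min_mul_of_nonneg _ _ (mul_nonneg (hq0 a).le (hq0 b).le)]
  congr 1
  · field_simp [(hq0 a).ne']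
  · field_simp [(hq0 b).ne']

omit [SFinite μ] in
/-- Measurability of the pair-minimum of importance ratios. [folklore] -/
theorem measurable_pairMin {p q : X → ℝ} (hpm : Measurable p) (hqm : Measurable q) :
    Measurable fun z : X × X => min (p z.1 / q z.1) (p z.2 / q z.2) :=
  ((hpm.comp measurable_fst).div (hqm.comp measurable_fst)).min
    ((hpm.comp measurable_snd).div (hqm.comp measurable_snd))

omit [MeasurableSpace X] [SFinite μ] in
/-- Range of the pair-minimum under a weight ceiling: `0 ≤ p ≤ Wq`, `q > 0` ⇒
`min(p(a)/q(a), p(b)/q(b)) ∈ [0, W]`. [folklore] -/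
theorem pairMin_mem_Icc {p q : X → ℝ} (hp0 : ∀ y, 0 ≤ p y) (hq0 : ∀ y, 0 < q y) {W : ℝ}
    (hW : ∀ y, p y ≤ W * q y) (z : X × X) :
    min (p z.1 / q z.1) (p z.2 / q z.2) ∈ Icc (0 : ℝ) W := by
  have h1 : p z.1 / q z.1 ≤ W := by rw [div_le_iff₀ (hq0 _)]; exact hW _
  exact ⟨le_min (div_nonneg (hp0 _) (hq0 _).le) (div_nonneg (hp0 _) (hq0 _).le),
    (min_le_left _ _).trans h1⟩

omit [MeasurableSpace X] [SFinite μ] in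
/-- `min(u, v)² ≤ u·v` for the two (nonnegative) importance ratios. [folklore] -/
theorem sq_pairMin_le_mul {p q : X → ℝ} (hp0 : ∀ y, 0 ≤ p y) (hq0 : ∀ y, 0 < q y) (z : X × X) :
    min (p z.1 / q z.1) (p z.2 / q z.2) ^ 2 ≤ (p z.1 / q z.1) * (p z.2 / q z.2) := by
  have hu : 0 ≤ p z.1 / q z.1 := div_nonneg (hp0 _) (hq0 _).le
  have hv : 0 ≤ p z.2 / q z.2 := div_nonneg (hp0 _) (hq0 _).le
  rcases le_total (p z.1 / q z.1) (p z.2 / q z.2) with h | h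
  · rw [min_eq_left h, sq]; exact mul_le_mul_of_nonneg_left h hu
  · rw [min_eq_right h, sq]; exact mul_le_mul_of_nonneg_right h hv

/-- **The pair-minimum integrates to the equilibrium acceptance:**
`∫ min(p/q ⊗ p/q)·(q ⊗ q) d(μ ⊗ μ) = ∫∫ min(p(a)q(b), p(b)q(a)) dμ dμ = acc(p, q)` (`p ≥ 0`
measurable integrable, `q > 0` measurable integrable). [ours] -/
theorem integral_pairMin_eq_meanAccept {p q : X → ℝ} (hp0 : ∀ y, 0 ≤ p y) (hpm : Measurable p)
    (hpi : Integrable p μ) (hq0 : ∀ y, 0 < q y) (hqm : Measurable q) (hqi : Integrable q μ) :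
    ∫ z, min (p z.1 / q z.1) (p z.2 / q z.2) * (q z.1 * q z.2) ∂(μ.prod μ)
      = ∫ a, ∫ b, min (p a * q b) (p b * q a) ∂μ ∂μ := by
  simp_rw [min_div_mul_eq_min_mul hq0]
  have hI : Integrable (fun z : X × X => min (p z.1 * q z.2) (p z.2 * q z.1)) (μ.prod μ) := by
    refine Integrable.mono' (hpi.mul_prod hqi) ?_ (Filter.Eventually.of_forall fun z => ?_)
    · exact (((hpm.comp measurable_fst).mul (hqm.comp measurable_snd)).min
        ((hpm.comp measurable_snd).mul (hqm.comp measurable_fst))).aestronglyMeasurable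
    · rw [Real.norm_eq_abs, abs_of_nonneg (le_min (mul_nonneg (hp0 _) (hq0 _).le)
        (mul_nonneg (hp0 _) (hq0 _).le))]
      exact min_le_left _ _
  rw [integral_prod _ hI]

/-- **Unbiasedness: `E min(w(x), w(x')) = acc(p, q)`** for an independent pair of model draws.
[ours] -/
theorem integral_pairMin_comp_eq_meanAccept {x x' : Ω → X} (hxm : Measurable x)
    (hxm' : Measurable x') (hin : IndepFun x x' P) {p q : X → ℝ} (hp0 : ∀ y, 0 ≤ p y)
    (hpm : Measurable p) (hpi : Integrable p μ) (hq0 : ∀ y, 0 < q y) (hqm : Measurable q)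
    (hqi : Integrable q μ) (hlaw : Measure.map x P = μ.withDensity fun y => ENNReal.ofReal (q y))
    (hlaw' : Measure.map x' P = μ.withDensity fun y => ENNReal.ofReal (q y)) :
    ∫ ω, min (p (x ω) / q (x ω)) (p (x' ω) / q (x' ω)) ∂P
      = ∫ a, ∫ b, min (p a * q b) (p b * q a) ∂μ ∂μ := by
  rw [← integral_pairMin_eq_meanAccept hp0 hpm hpi hq0 hqm hqi]
  exact integral_pair_eq hxm hxm' hin (fun y => (hq0 y).le) hqm hlaw hlaw' (measurable_pairMin hpm hqm)

/-- **Second moment `≤ 1`: `E min(w(x), w(x'))² ≤ E[w(x)w(x')] = (∫ p)² = 1`**, whatever the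
weight ceiling (none is needed: the integrand is dominated by `p ⊗ p`). [ours] -/
theorem integral_sq_pairMin_comp_le_one {x x' : Ω → X} (hxm : Measurable x) (hxm' : Measurable x')
    (hin : IndepFun x x' P) {p q : X → ℝ} (hp0 : ∀ y, 0 ≤ p y) (hpm : Measurable p)
    (hpi : Integrable p μ) (hp1 : ∫ y, p y ∂μ = 1) (hq0 : ∀ y, 0 < q y) (hqm : Measurable q)
    (hlaw : Measure.map x P = μ.withDensity fun y => ENNReal.ofReal (q y))
    (hlaw' : Measure.map x' P = μ.withDensity fun y => ENNReal.ofReal (q y)) :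
    ∫ ω, min (p (x ω) / q (x ω)) (p (x' ω) / q (x' ω)) ^ 2 ∂P ≤ 1 := by
  have hF2m : Measurable fun z : X × X => min (p z.1 / q z.1) (p z.2 / q z.2) ^ 2 :=
    (measurable_pairMin hpm hqm).pow_const 2
  rw [show (fun ω => min (p (x ω) / q (x ω)) (p (x' ω) / q (x' ω)) ^ 2)
      = fun ω => (fun z : X × X => min (p z.1 / q z.1) (p z.2 / q z.2) ^ 2) (x ω, x' ω) from rfl,
    integral_pair_eq hxm hxm' hin (fun y => (hq0 y).le) hqm hlaw hlaw' hF2m]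
  -- pointwise `min² · (q⊗q) ≤ (w⊗w)(q⊗q) = p⊗p`, and `∫ p⊗p = (∫p)² = 1`
  have hpt : ∀ z : X × X, min (p z.1 / q z.1) (p z.2 / q z.2) ^ 2 * (q z.1 * q z.2)
      ≤ p z.1 * p z.2 := fun z => by
    calc min (p z.1 / q z.1) (p z.2 / q z.2) ^ 2 * (q z.1 * q z.2)
        ≤ (p z.1 / q z.1) * (p z.2 / q z.2) * (q z.1 * q z.2) :=
          mul_le_mul_of_nonneg_right (sq_pairMin_le_mul hp0 hq0 z)
            (mul_nonneg (hq0 _).le (hq0 _).le)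
      _ = p z.1 * p z.2 := by field_simp [(hq0 z.1).ne', (hq0 z.2).ne']
  have hpp : Integrable (fun z : X × X => p z.1 * p z.2) (μ.prod μ) := hpi.mul_prod hpi
  have hnn : ∀ z : X × X, 0 ≤ min (p z.1 / q z.1) (p z.2 / q z.2) ^ 2 * (q z.1 * q z.2) :=
    fun z => mul_nonneg (sq_nonneg _) (mul_nonneg (hq0 _).le (hq0 _).le)
  have hI : Integrable (fun z : X × X => min (p z.1 / q z.1) (p z.2 / q z.2) ^ 2 * (q z.1 * q z.2))
      (μ.prod μ) :=
    Integrable.mono' hpp ((hF2m.mul ((hqm.comp measurable_fst).mul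
      (hqm.comp measurable_snd))).aestronglyMeasurable)
      (Filter.Eventually.of_forall fun z => by
        rw [Real.norm_eq_abs, abs_of_nonneg (hnn z)]; exact hpt z)
  calc ∫ z, min (p z.1 / q z.1) (p z.2 / q z.2) ^ 2 * (q z.1 * q z.2) ∂(μ.prod μ)
      ≤ ∫ z, p z.1 * p z.2 ∂(μ.prod μ) := integral_mono hI hpp hpt
    _ = 1 := by rw [integral_prod_mul, hp1, mul_one]

/-! ## §3 The two-sided certificate for `acc(p, q)` from `k` independent pairs -/

/-- **LOWER TAIL (the acceptance is not much above the pair estimate): rate `kt²/2`, independent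
of the weight ceiling.**  For `t ≥ 0`: `P( V + k t ≤ k·acc(p,q) ) ≤ exp(−k t²/2)` (Maurer / BLM
Ex. 2.9 with second moment `≤ 1`). [ours] -/
theorem acceptance_pairedDraws_lower {x x' : ι → Ω → X} (hxm : ∀ i, Measurable (x i))
    (hxm' : ∀ i, Measurable (x' i)) (hin : ∀ i, IndepFun (x i) (x' i) P)
    (hpair : iIndepFun (fun i ω => (x i ω, x' i ω)) P) {p q : X → ℝ} (hp0 : ∀ y, 0 ≤ p y)
    (hpm : Measurable p) (hpi : Integrable p μ) (hp1 : ∫ y, p y ∂μ = 1) (hq0 : ∀ y, 0 < q y)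
    (hqm : Measurable q) (hqi : Integrable q μ) {W : ℝ} (hW : ∀ y, p y ≤ W * q y)
    (hlaw : ∀ i, Measure.map (x i) P = μ.withDensity fun y => ENNReal.ofReal (q y))
    (hlaw' : ∀ i, Measure.map (x' i) P = μ.withDensity fun y => ENNReal.ofReal (q y))
    (s : Finset ι) {t : ℝ} (ht : 0 ≤ t) :
    P.real {ω | ∑ i ∈ s, min (p (x i ω) / q (x i ω)) (p (x' i ω) / q (x' i ω)) + s.card * t
        ≤ s.card * ∫ a, ∫ b, min (p a * q b) (p b * q a) ∂μ ∂μ}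
      ≤ Real.exp (-(s.card * t ^ 2 / 2)) := by
  set F : X × X → ℝ := fun z => min (p z.1 / q z.1) (p z.2 / q z.2) with hF
  have hFm : Measurable F := measurable_pairMin hpm hqm
  have hind : iIndepFun (fun i ω => F (x i ω, x' i ω)) P := hpair.comp (fun _ => F) fun _ => hFm
  have hmeas : ∀ i, AEStronglyMeasurable (fun ω => F (x i ω, x' i ω)) P := fun i =>
    (hFm.comp ((hxm i).prodMk (hxm' i))).aestronglyMeasurable
  have hLp : ∀ i, MemLp (fun ω => F (x i ω, x' i ω)) 2 P := fun i =>
    MemLp.of_bound (hmeas i) W (Filter.Eventually.of_forall fun ω => by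
      have h := pairMin_mem_Icc hp0 hq0 hW (x i ω, x' i ω)
      rw [Real.norm_eq_abs, abs_of_nonneg h.1]; exact h.2)
  have h0 : ∀ i, 0 ≤ᵐ[P] fun ω => F (x i ω, x' i ω) := fun i =>
    Filter.Eventually.of_forall fun ω => (pairMin_mem_Icc hp0 hq0 hW (x i ω, x' i ω)).1
  have hmean : ∀ i, ∫ a, ∫ b, min (p a * q b) (p b * q a) ∂μ ∂μ
      ≤ ∫ ω, F (x i ω, x' i ω) ∂P := fun i =>
    (integral_pairMin_comp_eq_meanAccept (hxm i) (hxm' i) (hin i) hp0 hpm hpi hq0 hqm hqi (hlaw i)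
      (hlaw' i)).ge
  have hsq : ∀ i, ∫ ω, F (x i ω, x' i ω) ^ 2 ∂P ≤ 1 := fun i =>
    integral_sq_pairMin_comp_le_one (hxm i) (hxm' i) (hin i) hp0 hpm hpi hp1 hq0 hqm (hlaw i)
      (hlaw' i)
  have h := Literature.Probability.Moments.measureReal_sum_add_le_card_mul_le_exp_of_sq_le hind
    hLp h0 hmean hsq ht s
  rw [mul_one] at h
  exact h

/-- **UPPER TAIL (the acceptance is not much below the pair estimate): Bernstein with variance
proxy `1` and bound `W`.**  For `t > 0` and `k = #s ≥ 1`: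
`P( k·(acc(p,q) + t) ≤ V ) ≤ exp(−k t²/(2(1 + W t/3)))`. [ours] -/
theorem acceptance_pairedDraws_upper {x x' : ι → Ω → X} (hxm : ∀ i, Measurable (x i))
    (hxm' : ∀ i, Measurable (x' i)) (hin : ∀ i, IndepFun (x i) (x' i) P)
    (hpair : iIndepFun (fun i ω => (x i ω, x' i ω)) P) {p q : X → ℝ} (hp0 : ∀ y, 0 ≤ p y)
    (hpm : Measurable p) (hpi : Integrable p μ) (hp1 : ∫ y, p y ∂μ = 1) (hq0 : ∀ y, 0 < q y)
    (hqm : Measurable q) (hqi : Integrable q μ) {W : ℝ} (hW : ∀ y, p y ≤ W * q y)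
    (hlaw : ∀ i, Measure.map (x i) P = μ.withDensity fun y => ENNReal.ofReal (q y))
    (hlaw' : ∀ i, Measure.map (x' i) P = μ.withDensity fun y => ENNReal.ofReal (q y))
    (s : Finset ι) (hs : 0 < s.card) {t : ℝ} (ht : 0 < t) :
    P.real {ω | s.card * ((∫ a, ∫ b, min (p a * q b) (p b * q a) ∂μ ∂μ) + t)
        ≤ ∑ i ∈ s, min (p (x i ω) / q (x i ω)) (p (x' i ω) / q (x' i ω))}
      ≤ Real.exp (-(s.card * t ^ 2 / (2 * (1 + W * t / 3)))) := by
  set F : X × X → ℝ := fun z => min (p z.1 / q z.1) (p z.2 / q z.2) with hF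
  have hWpos : 0 < W := by
    by_contra hW0
    have hp : ∀ y, p y = 0 := fun y => le_antisymm
      ((hW y).trans (mul_nonpos_of_nonpos_of_nonneg (not_lt.mp hW0) (hq0 y).le)) (hp0 y)
    simp [hp] at hp1
  have hFm : Measurable F := measurable_pairMin hpm hqm
  have hind : iIndepFun (fun i ω => F (x i ω, x' i ω)) P := hpair.comp (fun _ => F) fun _ => hFm
  have hmeas : ∀ i, AEStronglyMeasurable (fun ω => F (x i ω, x' i ω)) P := fun i =>
    (hFm.comp ((hxm i).prodMk (hxm' i))).aestronglyMeasurable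
  have hLp : ∀ i, MemLp (fun ω => F (x i ω, x' i ω)) 2 P := fun i =>
    MemLp.of_bound (hmeas i) W (Filter.Eventually.of_forall fun ω => by
      have h := pairMin_mem_Icc hp0 hq0 hW (x i ω, x' i ω)
      rw [Real.norm_eq_abs, abs_of_nonneg h.1]; exact h.2)
  have hb : ∀ i, ∀ᵐ ω ∂P, F (x i ω, x' i ω) ≤ W := fun i =>
    Filter.Eventually.of_forall fun ω => (pairMin_mem_Icc hp0 hq0 hW (x i ω, x' i ω)).2
  have hmean : ∀ i, ∫ ω, F (x i ω, x' i ω) ∂P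
      ≤ ∫ a, ∫ b, min (p a * q b) (p b * q a) ∂μ ∂μ := fun i =>
    (integral_pairMin_comp_eq_meanAccept (hxm i) (hxm' i) (hin i) hp0 hpm hpi hq0 hqm hqi (hlaw i)
      (hlaw' i)).le
  have hsq : ∀ i, ∫ ω, F (x i ω, x' i ω) ^ 2 ∂P ≤ 1 := fun i =>
    integral_sq_pairMin_comp_le_one (hxm i) (hxm' i) (hin i) hp0 hpm hpi hp1 hq0 hqm (hlaw i)
      (hlaw' i)
  have h := Literature.Probability.Moments.measureReal_card_mul_add_le_sum_le_exp_of_sq_le hind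
    hLp hWpos hb hmean one_pos hsq s hs ht
  exact h

/-- **THE TWO-SIDED CERTIFICATE FOR THE ACCEPTANCE COLUMN FROM PAIRED DRAWS.**  `p ≥ 0`
normalised, `q > 0` a model density with ceiling `p ≤ Wq`; `k = #s ≥ 1` independent pairs of
independent model draws with pair-minimum sum `V`; then for every `t > 0`:
`P( t ≤ |V/k − acc(p,q)| ) ≤ exp(−k t²/2) + exp(−k t²/(2(1 + W t/3)))`. [ours] -/
theorem acceptance_pairedDraws_confidence {x x' : ι → Ω → X} (hxm : ∀ i, Measurable (x i))
    (hxm' : ∀ i, Measurable (x' i)) (hin : ∀ i, IndepFun (x i) (x' i) P)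
    (hpair : iIndepFun (fun i ω => (x i ω, x' i ω)) P) {p q : X → ℝ} (hp0 : ∀ y, 0 ≤ p y)
    (hpm : Measurable p) (hpi : Integrable p μ) (hp1 : ∫ y, p y ∂μ = 1) (hq0 : ∀ y, 0 < q y)
    (hqm : Measurable q) (hqi : Integrable q μ) {W : ℝ} (hW : ∀ y, p y ≤ W * q y)
    (hlaw : ∀ i, Measure.map (x i) P = μ.withDensity fun y => ENNReal.ofReal (q y))
    (hlaw' : ∀ i, Measure.map (x' i) P = μ.withDensity fun y => ENNReal.ofReal (q y))
    (s : Finset ι) (hs : 0 < s.card) {t : ℝ} (ht : 0 < t) :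
    P.real {ω | t ≤ |(∑ i ∈ s, min (p (x i ω) / q (x i ω)) (p (x' i ω) / q (x' i ω))) / s.card
        - ∫ a, ∫ b, min (p a * q b) (p b * q a) ∂μ ∂μ|}
      ≤ Real.exp (-(s.card * t ^ 2 / 2))
        + Real.exp (-(s.card * t ^ 2 / (2 * (1 + W * t / 3)))) := by
  have hlo := acceptance_pairedDraws_lower hxm hxm' hin hpair hp0 hpm hpi hp1 hq0 hqm hqi hW hlaw
    hlaw' s ht.le
  have hup := acceptance_pairedDraws_upper hxm hxm' hin hpair hp0 hpm hpi hp1 hq0 hqm hqi hW hlaw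
    hlaw' s hs ht
  have hn : (0 : ℝ) < s.card := by exact_mod_cast hs
  set acc : ℝ := ∫ a, ∫ b, min (p a * q b) (p b * q a) ∂μ ∂μ with hacc
  set V : Ω → ℝ := fun ω => ∑ i ∈ s, min (p (x i ω) / q (x i ω)) (p (x' i ω) / q (x' i ω))
    with hV
  have hsub : {ω | t ≤ |V ω / s.card - acc|}
      ⊆ {ω | V ω + s.card * t ≤ s.card * acc} ∪ {ω | s.card * (acc + t) ≤ V ω} := by
    intro ω hω
    simp only [mem_setOf_eq, mem_union] at hω ⊢
    rcases le_or_gt (V ω / s.card) acc with h | h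
    · left
      rw [abs_of_nonpos (sub_nonpos.2 h)] at hω
      have : V ω / s.card ≤ acc - t := by linarith
      rw [div_le_iff₀ hn] at this
      linarith
    · right
      rw [abs_of_pos (sub_pos.2 h)] at hω
      have : acc + t ≤ V ω / s.card := by linarith
      rw [le_div_iff₀ hn] at this
      linarith
  calc P.real {ω | t ≤ |V ω / s.card - acc|}
      ≤ P.real ({ω | V ω + s.card * t ≤ s.card * acc} ∪ {ω | s.card * (acc + t) ≤ V ω}) :=
        measureReal_mono hsub
    _ ≤ P.real {ω | V ω + s.card * t ≤ s.card * acc} + P.real {ω | s.card * (acc + t) ≤ V ω} :=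
        measureReal_union_le _ _
    _ ≤ Real.exp (-(s.card * t ^ 2 / 2))
          + Real.exp (-(s.card * t ^ 2 / (2 * (1 + W * t / 3)))) := add_le_add hlo hup

/-! ## §4 The A-vs-B acceptance comparison without a parity hypothesis -/

/-- **A-vs-B ACCEPTANCE COMPARISON FROM PAIRED DRAWS, NO PARITY HYPOTHESIS.**  One normalised
target `p ≥ 0`; two model densities `q, q' > 0` (the two codes) with ceilings `p ≤ Wq`,
`p ≤ W'q'`; code A supplies `k = #s ≥ 1` independent pairs of its own independent draws (sum of
pair-minima `V`), code B supplies `k' = #s' ≥ 1` pairs (`V'`) — nothing is assumed between the two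
codes or between the two legs.  Then for `t, t' > 0`:
`P( t + t' ≤ |(V/k − V'/k') − (acc(p,q) − acc(p,q'))| )
≤ [e^{−kt²/2} + e^{−kt²/(2(1+Wt/3))}] + [e^{−k't'²/2} + e^{−k't'²/(2(1+W't'/3))}]` —
the two equilibrium acceptances differ by the difference of the pair estimates up to `±(t + t')`,
with that confidence. [ours] -/
theorem acceptance_AB_pairedDraws_confidence {p q q' : X → ℝ} (hp0 : ∀ y, 0 ≤ p y)
    (hpm : Measurable p) (hpi : Integrable p μ) (hp1 : ∫ y, p y ∂μ = 1) (hq0 : ∀ y, 0 < q y)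
    (hqm : Measurable q) (hqi : Integrable q μ) (hq0' : ∀ y, 0 < q' y) (hqm' : Measurable q')
    (hqi' : Integrable q' μ) {W W' : ℝ} (hW : ∀ y, p y ≤ W * q y) (hW' : ∀ y, p y ≤ W' * q' y)
    {x x' : ι → Ω → X} (hxm : ∀ i, Measurable (x i)) (hxm' : ∀ i, Measurable (x' i))
    (hin : ∀ i, IndepFun (x i) (x' i) P) (hpair : iIndepFun (fun i ω => (x i ω, x' i ω)) P)
    (hlaw : ∀ i, Measure.map (x i) P = μ.withDensity fun y => ENNReal.ofReal (q y))
    (hlaw' : ∀ i, Measure.map (x' i) P = μ.withDensity fun y => ENNReal.ofReal (q y))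
    {ι' : Type*} {z z' : ι' → Ω → X} (hzm : ∀ j, Measurable (z j)) (hzm' : ∀ j, Measurable (z' j))
    (hinz : ∀ j, IndepFun (z j) (z' j) P) (hpairz : iIndepFun (fun j ω => (z j ω, z' j ω)) P)
    (hlawz : ∀ j, Measure.map (z j) P = μ.withDensity fun y => ENNReal.ofReal (q' y))
    (hlawz' : ∀ j, Measure.map (z' j) P = μ.withDensity fun y => ENNReal.ofReal (q' y))
    (s : Finset ι) (s' : Finset ι') (hs : 0 < s.card) (hs' : 0 < s'.card) {t t' : ℝ}
    (ht : 0 < t) (ht' : 0 < t') :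
    P.real {ω | t + t'
        ≤ |((∑ i ∈ s, min (p (x i ω) / q (x i ω)) (p (x' i ω) / q (x' i ω))) / s.card
              - (∑ j ∈ s', min (p (z j ω) / q' (z j ω)) (p (z' j ω) / q' (z' j ω))) / s'.card)
            - ((∫ a, ∫ b, min (p a * q b) (p b * q a) ∂μ ∂μ)
              - ∫ a, ∫ b, min (p a * q' b) (p b * q' a) ∂μ ∂μ)|}
      ≤ (Real.exp (-(s.card * t ^ 2 / 2)) + Real.exp (-(s.card * t ^ 2 / (2 * (1 + W * t / 3)))))
        + (Real.exp (-(s'.card * t' ^ 2 / 2))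
          + Real.exp (-(s'.card * t' ^ 2 / (2 * (1 + W' * t' / 3))))) := by
  have hA := acceptance_pairedDraws_confidence hxm hxm' hin hpair hp0 hpm hpi hp1 hq0 hqm hqi hW
    hlaw hlaw' s hs ht
  have hB := acceptance_pairedDraws_confidence hzm hzm' hinz hpairz hp0 hpm hpi hp1 hq0' hqm' hqi'
    hW' hlawz hlawz' s' hs' ht'
  set acc : ℝ := ∫ a, ∫ b, min (p a * q b) (p b * q a) ∂μ ∂μ
  set acc' : ℝ := ∫ a, ∫ b, min (p a * q' b) (p b * q' a) ∂μ ∂μ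
  set U : Ω → ℝ := fun ω =>
    (∑ i ∈ s, min (p (x i ω) / q (x i ω)) (p (x' i ω) / q (x' i ω))) / s.card
  set U' : Ω → ℝ := fun ω =>
    (∑ j ∈ s', min (p (z j ω) / q' (z j ω)) (p (z' j ω) / q' (z' j ω))) / s'.card
  have hsub : {ω | t + t' ≤ |(U ω - U' ω) - (acc - acc')|}
      ⊆ {ω | t ≤ |U ω - acc|} ∪ {ω | t' ≤ |U' ω - acc'|} := by
    intro ω hω
    simp only [mem_setOf_eq, mem_union] at hω ⊢
    by_contra hcon
    obtain ⟨h1, h2⟩ := not_or.mp hcon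
    have h1 := not_le.mp h1
    have h2 := not_le.mp h2
    have : |(U ω - U' ω) - (acc - acc')| ≤ |U ω - acc| + |U' ω - acc'| := by
      rw [show (U ω - U' ω) - (acc - acc') = (U ω - acc) - (U' ω - acc') by ring]
      exact abs_sub _ _
    linarith
  calc P.real {ω | t + t' ≤ |(U ω - U' ω) - (acc - acc')|}
      ≤ P.real ({ω | t ≤ |U ω - acc|} ∪ {ω | t' ≤ |U' ω - acc'|}) := measureReal_mono hsub
    _ ≤ P.real {ω | t ≤ |U ω - acc|} + P.real {ω | t' ≤ |U' ω - acc'|} :=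
        measureReal_union_le _ _
    _ ≤ _ := add_le_add hA hB

end Summit.Ventures.LatticeQCDFlow.Scoring.PairedDraws

end
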